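import Mathlib
import Summits.Ventures.HodgeRepro2.T5CyclotomicSubfieldCyclicInert
import Summits.Ventures.HodgeRepro2.T5CyclotomicFifteenBiquadratic

/-!
# NO INERT PRIME IN A SUBFIELD OF `ℚ(ζₘ)` WITH NON-CYCLIC GALOIS GROUP

Tier-5 support N3 / §G-N4.2 (seat p3, gen 81). The converse of file 301: a prime `p ∤ m` is inert in `F ⊆ ℚ(ζₘ)`
iff `p · H_F` generates `(ℤ/mℤ)ˣ / H_F ≅ Gal(F/ℚ)`, so a non-cyclic Galois group admits NO inert prime —
`f(𝔭/p) < [F : ℚ]` for every `p ∤ m`.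

* **`isCyclic_gal_of_inertiaDeg_eq_finrank`**: an inert prime makes `Gal(F/ℚ)` cyclic;
* **`inertiaDeg_lt_finrank_of_not_isCyclic`**: `Gal(F/ℚ)` not cyclic ⟹ `f(𝔭/p) < [F : ℚ]` for every `p ∤ m`;
* `inertiaDeg_lt_four`: on the biquadratic `F = ℚ(√−3, √5)` of file 294, `f(𝔭/p) < 4` for every `p ∤ 15` (consistent
  with file 298's table `f ∈ {1, 2}`).

§8(d): uses an L-value-free non-vanishing device: NO.
-/

open NumberField IsCyclotomicExtension.Rat Ideal IsDedekindDomain IsDedekindDomain.HeightOneSpectrum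
open Summit.Ventures.HodgeRepro2.T5CyclotomicSubfieldInertiaDeg
  Summit.Ventures.HodgeRepro2.T5CyclotomicSubfieldCyclicInert

namespace Summit.Ventures.HodgeRepro2.T5CyclotomicSubfieldNoInert

section General

variable (m : ℕ) [NeZero m] (L : Type*) [Field L] [NumberField L] [IsCyclotomicExtension {m} ℚ L]
  (F : IntermediateField ℚ L)
variable (p : ℕ) [hp : Fact p.Prime] (hpm : p.Coprime m)
  (𝔭 : Ideal (𝓞 F)) [h𝔭 : 𝔭.IsPrime] [h𝔭p : 𝔭.LiesOver (span {(p : ℤ)})]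

include hpm h𝔭 h𝔭p in
/-- **An inert prime makes the Galois group cyclic**: `f(𝔭/p) = [F : ℚ]` means `p · H_F` has order `#((ℤ/mℤ)ˣ / H_F)`,
so it generates the quotient `≅ Gal(F/ℚ)`. -/
theorem isCyclic_gal_of_inertiaDeg_eq_finrank (hf : 𝔭.inertiaDeg ℤ = Module.finrank ℚ F) :
    IsCyclic (F ≃ₐ[ℚ] F) := by
  haveI : IsGalois ℚ F := T5CyclotomicUnramified.isGalois_intermediateField L m F
  have hord : orderOf (QuotientGroup.mk (ZMod.unitOfCoprime p hpm) : (ZMod m)ˣ ⧸ zmodSubgroup m L F) =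
      Nat.card ((ZMod m)ˣ ⧸ zmodSubgroup m L F) := by
    rw [← inertiaDeg_eq_orderOf_mk m L F p hpm 𝔭, hf, card_quotient]
  haveI : IsCyclic ((ZMod m)ˣ ⧸ zmodSubgroup m L F) :=
    isCyclic_of_orderOf_eq_card _ hord
  exact isCyclic_of_surjective (galEquivQuotient m L F).symm (galEquivQuotient m L F).symm.surjective

include hpm h𝔭 h𝔭p in
/-- **No inert prime for a non-cyclic Galois group**: `f(𝔭/p) < [F : ℚ]` for every `p ∤ m`. -/
theorem inertiaDeg_lt_finrank_of_not_isCyclic (hnc : ¬ IsCyclic (F ≃ₐ[ℚ] F)) :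
    𝔭.inertiaDeg ℤ < Module.finrank ℚ F := by
  have hle : 𝔭.inertiaDeg ℤ ≤ Module.finrank ℚ F :=
    Nat.le_of_dvd Module.finrank_pos (T5CyclotomicUnramified.inertiaDeg_dvd_finrank p L F
      ((Nat.Prime.coprime_iff_not_dvd hp.out).mp hpm) 𝔭)
  refine lt_of_le_of_ne hle fun hf => hnc ?_
  exact isCyclic_gal_of_inertiaDeg_eq_finrank m L F p hpm 𝔭 hf

end General

section Biquadratic

open Summit.Ventures.HodgeRepro2.T5CyclotomicFifteenBiquadratic

variable (L : Type*) [Field L] [NumberField L] [IsCyclotomicExtension {15} ℚ L]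

/-- On `F = ℚ(√−3, √5)` no prime `p ∤ 15` is inert: `f(𝔭/p) < 4`. -/
theorem inertiaDeg_lt_four (p : ℕ) [Fact p.Prime] (hpm : p.Coprime 15)
    (𝔭 : Ideal (𝓞 (fixedField L))) [𝔭.IsPrime] [𝔭.LiesOver (span {(p : ℤ)})] :
    𝔭.inertiaDeg ℤ < 4 := by
  rw [← finrank_fixedField L]
  exact inertiaDeg_lt_finrank_of_not_isCyclic 15 L (fixedField L) p hpm 𝔭 (not_isCyclic_gal L)

end Biquadratic

end Summit.Ventures.HodgeRepro2.T5CyclotomicSubfieldNoInert
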